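import Literature.MathematicalPhysics.QuantumFieldTheory.Balaban1983to89.B11Eq115KernelOp
import Literature.MathematicalPhysics.QuantumFieldTheory.Balaban1983to89.B9Eq33CovDerivVector

/-!
# `Balaban1983to89.B11Eq45HOperator` — T. Bałaban, *The variational problem and background fields in renormalization group method
# for lattice gauge theories*, Commun. Math. Phys. **102** (1985) 277–309 [Balaban1985Variational], (45)–(46) p. 285: THE OPERATOR `H`
# («The operators Δ, Q and R define the operator H … defined on configurations B») AS AN OBJECT — a continuous linear map from the
# block fields `B` on `𝔅_k` (size `|·|_{(−0)} = sup|B|`) INTO THE SPACE (115) over the concrete carriers of `B11Eq115Space`, with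
# `∇ = ∇^{U₀}` the covariant gradient of `B9Eq33CovDerivVector`, and its printed bound (46) DERIVED from kernel letters

statement-level skeleton of published theorems with citation tags; proofs where landed; nothing here is a claim about the
Yang–Mills mass gap

PDF held: `paper:balaban1985-cmp102-variational-background` (journal page = PDF page + 276); p. 285 (PDF 9) read as an IMAGE from the
render `pub-balaban/b2b-balaban-ref1/pages/1985-cmp102-variational-background/…-p009-x2.png` by this seat (2026-08-21).

THE PRINT (p. 285, verbatim).  *«The operators Δ, Q and R define the operator H. Let us recall that it is an operator defined on
configurations B and giving a minimum of the quadratic form ½⟨A, ΔA⟩ under the restrictions L^jηQ_jA = B on Λ_j, j = 0, 1, …, k,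
RD*A = 0. Thus it has the following properties L^jηQ_jHB = B on Λ_j, RD*HB = 0, (45) and the Theorem 3.12 from [5] implies
|HB| ≤ B₀(L^jη)^{−1}|B|, |∇HB| ≤ B₀(L^jη)^{−2}|B| on Ω_j. (46)»*  [5] = T. Bałaban, CMP **99** (1985) 389–434
[Balaban1985BackgroundPropagators]: H = GQ*(QGQ*)⁻¹ (3.126) p. 420 (tree: `B9SectDFP.eq_3126`, scalar matrices), its kernel
inequalities (3.133) p. 422 (tree: `B9.Ineq3133`, `B9.Thm312Printed` — citation statements).

WHY THIS FILE (cell context).  Letter (L4) of the NE9 ∕ lit-balaban letter map — the pub-balaban NE9 owner's «INTERFACE REQUEST NE9 (L4):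
`Hop (U₀) : NegSize L η levB 0 V →L[ℂ] Space115 …` — H of [B11] (45)–(46) ([B9] Thm 3.12); bound (46) displayed
(`B11KernelDictionary.ineq46_of_kernelBounds` is the reading)» (HOME/INBOX.md [NE9P1-G76-RESULT], 2026-08-21T15:1xZ).  The consumer is the
Sect. C regime `B11Eq174Chart.Regime H 0 C b 0 C₂ c₄ 0 a_C ε_C` of `NE9B11ChartAnalytic.chartHB_triple_of_twoRegimes` (pub-balaban), whose
ONLY letter about `H` is `norm_G : ∀ X, ‖H X‖ ≤ b‖X‖` = (46) in the currencies of `B11Eq115Space` (‖·‖ of `Space115` IS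
max{|·|_{(−1)}, |∇·|_{(−2)}}; ‖·‖ of `NegSize … 0` IS sup|·|).
* §1 `gradKernel c R k` — the DERIVED KERNEL: the covariant gradient `covGrad c R` of `B9Eq33CovDerivVector` applied to an
  operator-valued kernel in its first (bond) argument; **`covGrad_kernelLM`**: `∇(Kf) = (∇k)f` (the hypothesis `hD` of
  `B11Eq115KernelOp.kernelJetCLM`, PROVED for this `∇`).
* §2 **`Hop L η levB lev₀ lev₁ c R kH : NegSize L η levB 0 V →L[𝕜] Space115 L η lev₀ lev₁ (covGrad c R)`** — H as an OBJECT: the kernel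
  operator of the H-KERNEL `kH : Bond → 𝔅_k → (V →L V)` (a DATUM at this letter: print's H(x, y′) is built from [5]'s Δ, Q, R, G of the
  background, (3.126), which the tree holds as scalar-matrix algebra `B9SectDFP` and as citation statements, not yet as lattice terms);
  `equiv_Hop_apply` (`(HB)(b) = Σ_{y′} kH(b, y′) B(y′)`).
* §3 **(46) DERIVED**: `norm_Hop_le` — `‖H B‖_{(115)} ≤ B₀·‖B‖` from the two ROW-SUM LETTERS `rowSum 1 (L^{j}η) kH ≤ B₀`,
  `rowSum 1 (L^{j}η)² (∇kH) ≤ B₀` (the summed form of [5] (3.133); `B11KernelDictionary.ineq46_of_kernelBounds` is the ℝ-valued block-norm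
  reading of the same summation); **`Hop_pointwise`** = (46) VERBATIM: `L^{j(b)}η·|(HB)(b)| ≤ B₀|B|` and `(L^{j(p)}η)²·|(∇HB)(p)| ≤ B₀|B|`
  at every point; `opNorm_Hop_le`.
* §4 the printed instance of the data: `𝕜 = ℂ`, fibre an algebra `𝔸 ⊇ 𝔤ᶜ`, `R = adTransport U₀` (`R(U)X = UXU⁻¹`), `c = η⁻¹`:
  `HopAd` with the REQUEST's type `NegSize L η levB 0 𝔸 →L[ℂ] Space115 L η lev₀ lev₁ (covGrad ((η : ℂ)⁻¹) (adTransport U₀))` (the ℂ-scalar spelling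
  shared with the companion letters (L2)∕(L6), so that the three operators meet in ONE `chartHB115` — pub-balaban precision P-ne9leaf01-g63-1).
WHAT IS NOT CLAIMED.  (45) («L^jηQ_jHB = B on Λ_j, RD*HB = 0») is NOT typed here — it is a statement about [5]'s Q_j, R, D*, which are
not objects over these carriers yet (substrate letters; `B9SectDFP.eq_3126` certifies the scalar-matrix algebra `T·ℋ = ℋ`); (46) is NOT
proved from [5] Thm 3.12 — it is DERIVED from the displayed row-sum letters, i.e. exactly as far as print's «Theorem 3.12 from [5]
implies»; no kernel of Bałaban's is constructed.  Net new unproved facts: 0.  Filed by the pub-balaban NE9 crux-team leaf seat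
`b2b-balaban-t4-ne9-formalise-leaf-03` (gen 52) on the owner's INTERFACE REQUEST (L4); NEW file, nothing of lit-balaban's modified.
-/

noncomputable section

namespace Literature.MathematicalPhysics.QuantumFieldTheory.Balaban1983to89.B11Eq45HOperator

open Finset
open Literature.MathematicalPhysics.QuantumFieldTheory.Balaban1983to89.B11Eq115Space
open Literature.MathematicalPhysics.QuantumFieldTheory.Balaban1983to89.B11Eq115KernelOp
open Literature.MathematicalPhysics.QuantumFieldTheory.Balaban1983to89.B9Eq33CovDerivVector (covGrad covGrad_apply adTransport)
open B9SectCLatticeCarrier (Bond bpos btgt)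

variable {d : ℕ} {Pd : Fin d → ℕ} {β : Type*} [Fintype β] {𝕜 : Type*} [NontriviallyNormedField 𝕜] [CompleteSpace 𝕜]
  {V : Type*} [NormedAddCommGroup V] [NormedSpace 𝕜 V] [FiniteDimensional 𝕜 V]

/-! ## §1 The derived kernel: the covariant gradient of a kernel in its bond argument -/

omit [Fintype β] in
/-- **The derived kernel** `(∇k)((b, ν), y′) = c·(R(b) ∘ k((b₊, ν), y′) − k((b₋, ν), y′))` — `covGrad c R` of `B9Eq33CovDerivVector` applied to
the operator-valued kernel `k` in its first argument (the transporter `R(b)` of the background composed on the left; finite-dimensional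
fibre, so `R(b)` is continuous). [cite: Balaban1985Variational, (46) p.285; Balaban1985BackgroundPropagators, (3.3) p.391] -/
def gradKernel (c : 𝕜) (R : Bond d Pd → V →ₗ[𝕜] V) (k : Bond d Pd → β → (V →L[𝕜] V)) :
    Bond d Pd × Fin d → β → (V →L[𝕜] V) :=
  fun p y => c • ((LinearMap.toContinuousLinearMap (R p.1)).comp (k (btgt p.1, p.2) y) - k (bpos p.1, p.2) y)

omit [Fintype β] in
/-- Unfolding the derived kernel on a vector. [cite: Balaban1985BackgroundPropagators, (3.3) p.391] -/
theorem gradKernel_apply (c : 𝕜) (R : Bond d Pd → V →ₗ[𝕜] V) (k : Bond d Pd → β → (V →L[𝕜] V)) (p : Bond d Pd × Fin d) (y : β)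
    (v : V) : gradKernel c R k p y v = c • (R p.1 (k (btgt p.1, p.2) y v) - k (bpos p.1, p.2) y v) := rfl

/-- **`∇(Kf) = (∇k)f`**: the covariant gradient of a kernel operator's output is the kernel operator of the derived kernel — the hypothesis
`hD` of `B11Eq115KernelOp.kernelJetCLM`, PROVED for `∇ = covGrad c R`. [cite: Balaban1985Variational, (46) p.285; Balaban1985BackgroundPropagators, (3.3) p.391] -/
theorem covGrad_kernelLM (c : 𝕜) (R : Bond d Pd → V →ₗ[𝕜] V) (k : Bond d Pd → β → (V →L[𝕜] V)) (f : β → V) :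
    covGrad c R (kernelLM k f) = kernelLM (gradKernel c R k) f := by
  funext p
  obtain ⟨b, ν⟩ := p
  rw [covGrad_apply, kernelLM_apply, kernelLM_apply, kernelLM_apply, map_sum, ← sum_sub_distrib, smul_sum]
  exact sum_congr rfl fun y _ => (gradKernel_apply c R k (b, ν) y (f y)).symm

/-! ## §2 H as an object: the kernel operator of the H-kernel into the space (115) -/

section Hop

variable (L η : ℝ) [Fact (0 < L)] [Fact (0 < η)] (levB : β → ℕ) (lev₀ : Bond d Pd → ℕ) (lev₁ : Bond d Pd × Fin d → ℕ)
  (c : 𝕜) (R : Bond d Pd → V →ₗ[𝕜] V)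

/-- **THE OPERATOR H of (45)–(46) AS AN OBJECT on the concrete carriers**: block fields `B` on `𝔅_k` (index `β`, size `|·|_{(−0)}`) ↦ the
configuration `(HB)(b) = Σ_{y′} kH(b, y′)B(y′)` in the space (115) normed by `max{|·|_{(−1)}, |∇^{U₀}·|_{(−2)}}` (`∇^{U₀} = covGrad c R`), for an
H-KERNEL `kH` (a DATUM: print's H = GQ*(QGQ*)⁻¹ of [5] (3.126) at the background U₀). [cite: Balaban1985Variational, (45)–(46) p.285; Balaban1985BackgroundPropagators, (3.126) p.420] -/
def Hop (kH : Bond d Pd → β → (V →L[𝕜] V)) : NegSize L η levB 0 V →L[𝕜] Space115 L η lev₀ lev₁ (covGrad c R) :=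
  kernelJetCLM (levWeight L η levB 0) (levWeight L η lev₀ 1) (levWeight L η lev₁ 2) (covGrad c R) kH (gradKernel c R kH)
    (covGrad_kernelLM c R kH)

/-- Reading `H` pointwise: `(HB)(b) = Σ_{y′} kH(b, y′) B(y′)`. [cite: Balaban1985Variational, (45) p.285] -/
@[simp] theorem equiv_Hop_apply (kH : Bond d Pd → β → (V →L[𝕜] V)) (B : NegSize L η levB 0 V) (b : Bond d Pd) :
    JetSup.equiv _ _ (covGrad c R) (Hop L η levB lev₀ lev₁ c R kH B) b = ∑ y, kH b y (NegSup.equiv _ V B y) := rfl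

/-! ## §3 (46) derived from the row-sum letters -/

/-- **(46) DERIVED — `‖HB‖_{(115)} ≤ B₀·‖B‖`**: if the weighted row sums of the H-kernel against `L^{j(b)}η` and of its derived kernel against
`(L^{j(p)}η)²` (block fields weighted by `(L^jη)⁰ = 1`) are all `≤ B₀` — the summed form of [5] (3.133) — then `H` has norm `≤ B₀` from
`|·|_{(−0)}` into the space (115): print's «Theorem 3.12 from [5] implies (46)», with the implication made a theorem and Theorem 3.12's
content left in the two letters. This is the Sect. C regime's `Regime.norm_G` for `B11Eq174Chart` ∕ the NE9 consumer.
[cite: Balaban1985Variational, (46) p.285] -/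
theorem norm_Hop_le {kH : Bond d Pd → β → (V →L[𝕜] V)} {B₀ : ℝ} (hB₀ : 0 ≤ B₀)
    (h₀ : ∀ b, rowSum (levWeight L η levB 0) (levWeight L η lev₀ 1) kH b ≤ B₀)
    (h₁ : ∀ p, rowSum (levWeight L η levB 0) (levWeight L η lev₁ 2) (gradKernel c R kH) p ≤ B₀) (B : NegSize L η levB 0 V) :
    ‖Hop L η levB lev₀ lev₁ c R kH B‖ ≤ B₀ * ‖B‖ :=
  norm_kernelJetCLM_le _ _ _ _ (covGrad_kernelLM c R kH) hB₀ h₀ h₁ B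

/-- The operator-norm form of (46): `‖H‖ ≤ B₀`. [cite: Balaban1985Variational, (46) p.285] -/
theorem opNorm_Hop_le {kH : Bond d Pd → β → (V →L[𝕜] V)} {B₀ : ℝ} (hB₀ : 0 ≤ B₀)
    (h₀ : ∀ b, rowSum (levWeight L η levB 0) (levWeight L η lev₀ 1) kH b ≤ B₀)
    (h₁ : ∀ p, rowSum (levWeight L η levB 0) (levWeight L η lev₁ 2) (gradKernel c R kH) p ≤ B₀) :
    ‖Hop L η levB lev₀ lev₁ c R kH‖ ≤ B₀ :=
  ContinuousLinearMap.opNorm_le_bound _ hB₀ (norm_Hop_le L η levB lev₀ lev₁ c R hB₀ h₀ h₁)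

/-- **(46) VERBATIM, pointwise on the lattice**: under the two row-sum letters, `L^{j(b)}η·|(HB)(b)| ≤ B₀·|B|` at every bond and
`(L^{j(p)}η)²·|(∇HB)(p)| ≤ B₀·|B|` at every derivative point, `|B|` the sup size of the block field — print's «|HB| ≤ B₀(L^jη)^{−1}|B|,
|∇HB| ≤ B₀(L^jη)^{−2}|B| on Ω_j». [cite: Balaban1985Variational, (46) p.285] -/
theorem Hop_pointwise {kH : Bond d Pd → β → (V →L[𝕜] V)} {B₀ : ℝ} (hB₀ : 0 ≤ B₀)
    (h₀ : ∀ b, rowSum (levWeight L η levB 0) (levWeight L η lev₀ 1) kH b ≤ B₀)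
    (h₁ : ∀ p, rowSum (levWeight L η levB 0) (levWeight L η lev₁ 2) (gradKernel c R kH) p ≤ B₀) (B : NegSize L η levB 0 V) :
    (∀ b, L ^ lev₀ b * η * ‖JetSup.equiv _ _ (covGrad c R) (Hop L η levB lev₀ lev₁ c R kH B) b‖ ≤ B₀ * ‖B‖) ∧
      ∀ p, (L ^ lev₁ p * η) ^ 2 * ‖covGrad c R (JetSup.equiv _ _ (covGrad c R) (Hop L η levB lev₀ lev₁ c R kH B)) p‖ ≤ B₀ * ‖B‖ := by
  have h := (JetSup.norm_le_iff_pointwise (mul_nonneg hB₀ (norm_nonneg B))).1 (norm_Hop_le L η levB lev₀ lev₁ c R hB₀ h₀ h₁ B)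
  simp only [levWeight, pow_one] at h
  exact h

/-- The block field's sup size read pointwise: `|B(y′)| ≤ ‖B‖` (weight `(L^jη)⁰ = 1`). [cite: Balaban1985Variational, (46) p.285] -/
theorem norm_apply_le_norm (B : NegSize L η levB 0 V) (y : β) : ‖NegSup.equiv _ V B y‖ ≤ ‖B‖ := by
  have h := NegSup.weight_mul_norm_apply_le B y
  simp only [levWeight, pow_zero, one_mul] at h
  exact h

end Hop

/-! ## §4 The printed instance of the data: `R(U)X = UXU⁻¹`, `c = η⁻¹`, fibre an algebra over `ℂ` -/

section Printed

variable {𝔸 : Type*} [NormedRing 𝔸] [NormedAlgebra ℂ 𝔸] [FiniteDimensional ℂ 𝔸]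
  (L η : ℝ) [Fact (0 < L)] [Fact (0 < η)] (levB : β → ℕ) (lev₀ : Bond d Pd → ℕ) (lev₁ : Bond d Pd × Fin d → ℕ)

/-- **`Hop (U₀)` with the REQUEST's type**: fibre an algebra `𝔸 ⊇ 𝔤ᶜ` (e.g. `Matrix (Fin N) (Fin N) ℂ`), transporter `R(U₀(b))X = U₀(b)XU₀(b)⁻¹`
(`adTransport U₀`), weight `c = η⁻¹` spelled `((η : ℂ)⁻¹)` — `NegSize L η levB 0 𝔸 →L[ℂ] Space115 L η lev₀ lev₁ (covGrad ((η : ℂ)⁻¹) (adTransport U₀))`.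
The ∇ is ONE TERM character for character (the jet space is indexed by it): `((η : ℂ)⁻¹)`, not `↑(η⁻¹)` and not the real-scalar literal —
the spelling of the companion letter (L2) `frakG`, so that (L2)∕(L4)∕(L6) meet in one `chartHB115` without casts (pub-balaban precision
P-ne9leaf01-g63-1). [cite: Balaban1985Variational, (45)–(46) p.285; Balaban1985BackgroundPropagators, (3.3) p.390] -/
abbrev HopAd (U₀ : Bond d Pd → 𝔸ˣ) (kH : Bond d Pd → β → (𝔸 →L[ℂ] 𝔸)) :
    NegSize L η levB 0 𝔸 →L[ℂ] Space115 L η lev₀ lev₁ (covGrad ((η : ℂ)⁻¹) (adTransport U₀)) :=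
  Hop L η levB lev₀ lev₁ ((η : ℂ)⁻¹) (adTransport U₀) kH

/-- (46) for `HopAd`: `‖H B‖ ≤ B₀‖B‖` from the two row-sum letters. [cite: Balaban1985Variational, (46) p.285] -/
theorem norm_HopAd_le (U₀ : Bond d Pd → 𝔸ˣ) {kH : Bond d Pd → β → (𝔸 →L[ℂ] 𝔸)} {B₀ : ℝ} (hB₀ : 0 ≤ B₀)
    (h₀ : ∀ b, rowSum (levWeight L η levB 0) (levWeight L η lev₀ 1) kH b ≤ B₀)
    (h₁ : ∀ p, rowSum (levWeight L η levB 0) (levWeight L η lev₁ 2) (gradKernel ((η : ℂ)⁻¹) (adTransport U₀) kH) p ≤ B₀)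
    (B : NegSize L η levB 0 𝔸) : ‖HopAd L η levB lev₀ lev₁ U₀ kH B‖ ≤ B₀ * ‖B‖ :=
  norm_Hop_le L η levB lev₀ lev₁ _ _ hB₀ h₀ h₁ B

end Printed

end Literature.MathematicalPhysics.QuantumFieldTheory.Balaban1983to89.B11Eq45HOperator

end
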